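import Summits.ValiantsHypothesis.ValiantsHypothesis.Theses.MonotoneRestoration
import Literature.Computability.AlgebraicComplexity.PatternExpressions

/-!
# ValiantsHypothesis / MonotoneRestoration — item `LinearVolumeKill` (stmt-ValiantsHypothesis-18298), closed

Kill glue for the re-target: `¬ OrbitRestorationLinearVolumeQP → ¬ OrbitRestorationQP`, i.e.
`OrbitRestorationQP → OrbitRestorationLinearVolumeQP`: a `VP` family that is a linear combination of
homomorphism polynomials `homPoly E n ℂ` is matrix-symmetric (`rename_perm_homPoly` and
`MvPolynomial.rename_C`), so `OrbitRestorationQP` (stated for matrix-symmetric `VP` families) applies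
to it verbatim. HONEST FRAMING: bookkeeping; both statements are OPEN; nothing here is progress on
`VP ≠ VNP`.
-/

-- layout Summits/ValiantsHypothesis/ValiantsHypothesis forces the duplicated namespace component
set_option linter.dupNamespace false

namespace Summit.ValiantsHypothesis.ValiantsHypothesis.Theorems.MonotoneRestoration

open MvPolynomial

/-- **Item `LinearVolumeKill` (stmt-ValiantsHypothesis-18298):**
`¬ OrbitRestorationLinearVolumeQP → ¬ OrbitRestorationQP` (contraposed: a hom-polynomial combination
is matrix-symmetric, so the general restoration statement specialises). [folklore] -/
theorem linearVolumeKill_proof : Theses.MonotoneRestoration.LinearVolumeKill := by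
  unfold Theses.MonotoneRestoration.LinearVolumeKill Theses.MonotoneRestoration.OrbitRestorationQP
    Theses.MonotoneRestoration.OrbitRestorationLinearVolumeQP
  intro hnot hQP
  apply hnot
  intro f hVP hrepr
  refine hQP f ?_ hVP
  intro n σ τ
  obtain ⟨c, m, a, b, E, α, -, -, hf⟩ := hrepr
  rw [hf n, map_sum]
  refine Finset.sum_congr rfl fun i _ => ?_
  rw [map_mul, rename_C, Literature.Computability.AlgebraicComplexity.rename_perm_homPoly]

end Summit.ValiantsHypothesis.ValiantsHypothesis.Theorems.MonotoneRestoration
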